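import Summits.BirchSwinnertonDyer.BirchSwinnertonDyer.Theorems.SignedLowerHalvesSprungLowerHalfAtThreeSplitConverseLocal
import Summits.BirchSwinnertonDyer.Rank1Residual.Additive.LocalTowerKernelCardEqTamagawaCyclotomic
import Literature.NumberTheory.EllipticCurves.Sprung2024.ChromaticKerGLocalBoundProofs
import Literature.NumberTheory.EllipticCurves.Sprung2024.ChromaticCharValueRankZeroProofs
import Literature.NumberTheory.EllipticCurves.Sprung2024.ChromaticLocalInjectivityUncondProofs
import Literature.NumberTheory.EllipticCurves.TamagawaSubgroupProofs
import HarnessLib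

/-!
# Crux 5 `SprungLowerHalfAtThree` WITHOUT K3: the ♯/♭ `Γ`-Euler characteristic enters the Eisenstein
# half only through the INEQUALITY `ord_p f⋆(0) ≤ ord_p ∏ c_l + ord_p #Sel`, and that inequality is a
# KERNEL THEOREM (no Poitou–Tate, no Sprung 2024 §5.2) — `sprungLowerHalfAtThree_of_K1_S4`

Summit `BirchSwinnertonDyer`, sub-problem `BirchSwinnertonDyer`, route K3 `SignedLowerHalves`, crux 5 =
stmt-BirchSwinnertonDyer-19003 (split rev 13–16: K1 `SprungLowerDivisibilityAtThree` = 19875 OPEN, K2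
= 19877, K3 `SharpFlatCharValueRankZeroAllLevels` = 19878, S4 `SharpFlatPublishedInputsAtThree` =
19929). Cell `bsd-ssimc`, seat `bsd-ssimc-k3c5-kdot-split` g7, object «KDOT-K3-BYPASS» (planner D30-5,
no veto); theorems only (`--supports stmt-BirchSwinnertonDyer-19003 --as helper`). PARTITION: X8 (A8:
`p = 3` good supersingular, `a₃ = ±3`, all conductors) × crux 5; proves-the-reduction-of; closes NONE;
0 census moves; BSD is not proved by any of this.

## The observation

Clause (B) of the crux asks for SOME `ξ ∈ Λ` with Kim's identity `ξ(0) = u · p^{ord_p ∏ c_l} · #Sel`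
EXACTLY (`SignedDatum.EulerCharacteristic`) and `ξ ∈ ϖ·L⋆·Λ`. K1 gives a generator `gen` of
`char(X⋆)` with `ι gen = ϖ · ι(L⋆ · h)`; if only **`ord_p gen(0) ≤ ord_p ∏ c_l + ord_p #Sel`** (and
`gen(0) ≠ 0`), then `ξ := p^k · gen` (`k` = the defect) satisfies Kim's identity exactly and is still
divisible by `ϖ·L⋆`. So the crux never needed the EQUALITY K3 (= Sprung 2024 §5.2 Lemmas 5.5 · 5.8 ·
5.9), only its Eisenstein half — and that half is Poitou–Tate-free:

* `f(0) · #(Sel⋆_∞)_γ = u · #Sel_{p^∞}(E/ℚ) · #ker g` (Lemmas 5.8 × 5.9, kernel: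
  `Sprung2024.constantCoeff_charGenerator_mul_natCard_sharpFlatEndCoinvariants_rat`, file
  `ChromaticEulerCharAssemblyProofs`), `ker g = A⋆_0/Sel_0`;
* `#ker g ∣ ∏_{bad l ≠ p} #𝒦_{l,0}[p^∞]` (Greenberg p. 104 "`ker(g) = ker(r) ∩ 𝒢`" + "`r_p` is
  injective" = `Sprung2024.lem55AllN_…_holds`, cell `pub/bsd-cited` p512438; kernel:
  `Sprung2024.natCard_sharpFlatKerG_dvd_prod_natCard_localTowerKerPrimary`, file
  `ChromaticKerGLocalBoundProofs`);
* `#𝒦_{l,0}[p^∞] = p^{ord_p c_l}` (Greenberg p. 88; kernel, class-closure lane: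
  `Rank1Residual.Additive.natCard_localTowerKerPrimary_zero_eq_pow_of_isCyclotomic`);
hence `#ker g ∣ ∏_l c_l` (§1) and `ord_p f(0) + ord_p #(Sel⋆_∞)_γ = ord_p #Sel + ord_p #ker g ≤
ord_p #Sel + ord_p ∏ c_l` (§2: `p^k · f(0) = u' · p^{ord_p ∏ c_l} · #Sel`).

## Contents
* §1 `natCard_sharpFlatKerG_dvd_tamagawaProduct` — `#ker g ∣ ∏_v c_v` over `ℚ`, `κ` cyclotomic.
* §2 `exists_pow_mul_constantCoeff_charGenerator_eq` — for `W/ℚ`, `p ≠ 2` good supersingular, the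
  cyclotomic / Honda setting, either colour, any datum `D` with `X⋆` finitely generated torsion and
  `char(X⋆) = (f)`, `Sel_{p^∞}(E/ℚ)` finite: `∃ k u', p^k · f(0) = u' · p^{ord_p ∏ c_l} · #Sel_{p^∞}(E/ℚ)`.
* §3 the roads: `sprungLowerHalfAtThree_of_K1_S4` (**ROUTE-GLUE form: `K1 → S4 → crux 5`**, S4
  supplying (M) a newform, (H) a Honda system, (T) cotorsion);
  `sprungLowerHalfAtThree_of_lowerDivisibility_katoFree` (**binder form: `K1 → thm22 → exists_isNewformOf
  → crux 5`**, cotorsion by control, Props. 7.3 / 7.6 / Lemma 5.5 (v = p) DISCHARGED by the tree);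
  `sharpFlatRankZeroConverseAtThree_katoFree` (K2 with the same binders dropped).

NET NAMED INPUTS of crux 5 along `…_of_lowerDivisibility_katoFree`: K1 (OPEN) +
`Sprung2012.thm22_exists_isHondaSystem` + `exists_isNewformOf` (BCDT). Sprung 2024 §5.2 (K3, Lemma 5.5,
Lemmas 5.5(p)–5.9), Sprung 2012 Props. 7.3/7.6, Lemma 2.3, Thm. 7.14 and Greenberg's §3–§4 counts are
kernel theorems or unnecessary on this road. CONDITIONAL on K1 (OPEN) and the named facts; closes
nothing.

## References
* [Sprung2024] F. Sprung, Adv. Math. 449 (2024) 109741, §5.2 pp. 39–41.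
* [GreenbergLNM1716] R. Greenberg, LNM 1716 (1999), §3 Lemma 3.3 and p. 88, §4 pp. 102–104.
* [Sprung2012] F. Sprung, J. Number Theory 132 (2012): Thm. 2.2, Main Conj. 7.21.
* [BCDTJAMS2001] Breuil–Conrad–Diamond–Taylor, Thm. A (modularity).
-/

set_option autoImplicit false
-- justification: the mandated namespace `Summit.BirchSwinnertonDyer.BirchSwinnertonDyer.Theorems`
-- (single-conjunct summit, Sub = Summit) repeats a segment by design (D-0017).
set_option linter.dupNamespace false

noncomputable section

open scoped Classical NumberField

namespace Summit.BirchSwinnertonDyer.BirchSwinnertonDyer.Theorems.SprungLowerHalfAtThreeSplit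

open NumberField IsDedekindDomain WeierstrassCurve CongruenceSubgroup
  Literature.NumberTheory.EllipticCurves Literature.NumberTheory.EllipticCurves.ModularForms
  Literature.NumberTheory.EllipticCurves.Rank1Residual
  Literature.NumberTheory.EllipticCurves.Sprung2017 Literature.NumberTheory.EllipticCurves.Sprung2012
  Literature.NumberTheory.EllipticCurves.Sprung2024 Literature.NumberTheory.EllipticCurves.ZpExtension
  Literature.NumberTheory.EllipticCurves.IwasawaDual
  Summit.BirchSwinnertonDyer.Rank1Residual.Supersingular
  Summit.BirchSwinnertonDyer.BirchSwinnertonDyer.Theses.SignedLowerHalves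

/-! ## §1 `#ker g ∣ ∏_v c_v` -/

/-- **`#ker g = #(A⋆_0/Sel_0)` divides the Tamagawa product `∏_v c_v`** for `W/ℚ` elliptic and
globally minimal, `p ≠ 2` good supersingular (`p ∣ a_p`), the cyclotomic `ℤ_p`-extension `κ`, the place
`v ∋ p` with the chosen embedding, a local lift `g` of a generator and a Honda system `(cneg, c)`, either
colour: `#ker g ∣ ∏_{bad l ≠ p} #𝒦_{l,0}[p^∞]`
(`Sprung2024.natCard_sharpFlatKerG_dvd_prod_natCard_localTowerKerPrimary`, with "`r_p` is injective" =
`Sprung2024.lem55AllN_…_holds`) `= ∏_{bad l ≠ p} p^{ord_p c_l}`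
(`Rank1Residual.Additive.natCard_localTowerKerPrimary_zero_eq_pow_of_isCyclotomic`, Greenberg p. 88)
`∣ ∏_{bad l} c_l = ∏_v c_v` (`c_v = 1` at good `v`). Greenberg, LNM 1716, p. 104: `ker(g) ⊆ ker(r)`,
`|ker(r)| = ∏_v |ker(r_v)|`, `|ker(r_v)| = c_v^{(p)}`. [cite: GreenbergLNM1716, §4 p. 104 and §3 p. 88]
[cite: Sprung2024, §5.2 proof of Lemma 5.5 (p. 40)] -/
theorem natCard_sharpFlatKerG_dvd_tamagawaProduct (W : WeierstrassCurve ℚ) [W.IsElliptic]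
    [W.IsGloballyMinimal] (p : ℕ) [Fact p.Prime] (hp2 : p ≠ 2) (hgood : W.HasGoodReductionAtPrime p)
    (hap : (p : ℤ) ∣ W.frobeniusTrace p) {κ : ZpExtension ℚ p} (hκ : κ.IsCyclotomic)
    (v : HeightOneSpectrum (𝓞 ℚ)) (hv : (p : 𝓞 ℚ) ∈ v.asIdeal)
    {g : Field.absoluteGaloisGroup (v.adicCompletion ℚ)}
    (hg : κ.IsTopGenerator (resGalOfEmb (closureEmb (K := ℚ) (v.adicCompletion ℚ)) g))
    {cneg : localPoints W (v.adicCompletion ℚ)} {c : ℕ → localPoints W (v.adicCompletion ℚ)}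
    (hH : IsHondaSystem κ (closureEmb (K := ℚ) (v.adicCompletion ℚ)) W (W.frobeniusTrace p) g cneg c)
    (col : Chroma) :
    Nat.card (↥((sharpFlatSelmerInfty W κ (closureEmb (K := ℚ) (v.adicCompletion ℚ))
        (W.frobeniusTrace p) g c col).comap (W.layerToInfty κ 0)) ⧸
      (W.selmerLayer κ 0).addSubgroupOf
        ((sharpFlatSelmerInfty W κ (closureEmb (K := ℚ) (v.adicCompletion ℚ))
          (W.frobeniusTrace p) g c col).comap (W.layerToInfty κ 0))) ∣ W.tamagawaProduct := by
  -- the finite set of bad places not above `p`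
  have hbad : (W.badPlaces (𝓞 ℚ)).Finite := W.finite_badPlaces_holds (𝓞 ℚ)
  let B : Finset (HeightOneSpectrum (𝓞 ℚ)) := hbad.toFinset
  let S : Finset (HeightOneSpectrum (𝓞 ℚ)) := B.filter fun w ↦ (p : 𝓞 ℚ) ∉ w.asIdeal
  have hB : ∀ w : HeightOneSpectrum (𝓞 ℚ), w ∈ B ↔ ¬ W.HasGoodReductionAt w := fun w ↦ by
    simp only [B, Set.Finite.mem_toFinset, WeierstrassCurve.badPlaces, Set.mem_setOf_eq]
  have hS : ∀ w : HeightOneSpectrum (𝓞 ℚ), w ∈ S ↔ ¬ W.HasGoodReductionAt w ∧ (p : 𝓞 ℚ) ∉ w.asIdeal :=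
    fun w ↦ by rw [Finset.mem_filter, hB]
  have hS' : ∀ w : HeightOneSpectrum (𝓞 ℚ), w ∉ S → (p : 𝓞 ℚ) ∉ w.asIdeal → W.HasGoodReductionAt w := by
    intro w hw hpw
    by_contra hng
    exact hw ((hS w).mpr ⟨hng, hpw⟩)
  -- `#ker g ∣ ∏_{w ∈ S} #𝒦_{w,0}[p^∞]` ("`r_p` is injective" is a tree theorem)
  have h1 := natCard_sharpFlatKerG_dvd_prod_natCard_localTowerKerPrimary W p κ v hv g c col
    (lem55AllN_sharpFlat_localKerOver_of_layerToInfty_mem_holds W p hp2 hgood hap κ hκ v hv g hg cneg c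
      hH col) S hS'
  -- `∏_{w ∈ S} #𝒦_{w,0}[p^∞] ∣ ∏_{w ∈ S} c_w` (Greenberg p. 88, kernel)
  have h2 : ∏ w ∈ S, Nat.card (W.localTowerKerPrimary κ (w.adicCompletion ℚ) 0) ∣
      ∏ w ∈ S, (W.baseChange (w.adicCompletion ℚ)).localTamagawaNumber (w.adicCompletionIntegers ℚ) := by
    refine Finset.prod_dvd_prod_of_dvd _ _ fun w hw ↦ ?_
    rw [Summit.BirchSwinnertonDyer.Rank1Residual.Additive.natCard_localTowerKerPrimary_zero_eq_pow_of_isCyclotomic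
      W hκ ((hS w).mp hw).2]
    exact pow_padicValNat_dvd
  -- `∏_{w ∈ S} c_w ∣ ∏_{w ∈ B} c_w = ∏_v c_v`
  have hsupp : (Function.mulSupport fun w : HeightOneSpectrum (𝓞 ℚ) ↦
      (W.baseChange (w.adicCompletion ℚ)).localTamagawaNumber (w.adicCompletionIntegers ℚ)) ⊆ ↑B := by
    intro w hw
    rw [Finset.mem_coe, hB]
    intro hgw
    exact hw (W.localTamagawaNumber_eq_one_of_hasGoodReductionAt_holds w hgw)
  have h3 : ∏ w ∈ S, (W.baseChange (w.adicCompletion ℚ)).localTamagawaNumber (w.adicCompletionIntegers ℚ) ∣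
      W.tamagawaProduct := by
    rw [WeierstrassCurve.tamagawaProduct, finprod_eq_prod_of_mulSupport_subset _ hsupp]
    exact Finset.prod_dvd_prod_of_subset S B _ (Finset.filter_subset _ B)
  exact h1.trans (h2.trans h3)

/-! ## §2 `p^k · f⋆(0) = u · p^{ord_p ∏ c_l} · #Sel_{p^∞}(E/ℚ)` -/

/-- Bookkeeping in `ℤ_p`: if `x · a = u · s · b` with natural numbers `a ≠ 0`, `b ∣ T ≠ 0` and a unit
`u`, then `p^k · x = u' · p^{ord_p T} · s` for some `k` and some unit `u'` (namely `k = ord_p(a·T/b)`;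
the prime-to-`p` parts of naturals are `p`-adic units). [folklore] -/
theorem exists_pow_mul_eq_unit_mul_pow_padicValNat_mul {p : ℕ} [Fact p.Prime] (x : ℤ_[p])
    {a b s T : ℕ} (ha : a ≠ 0) (hT : T ≠ 0) (hbT : b ∣ T) (u : ℤ_[p]ˣ)
    (h : x * (a : ℤ_[p]) = (u : ℤ_[p]) * s * b) :
    ∃ (k : ℕ) (u' : ℤ_[p]ˣ), (p : ℤ_[p]) ^ k * x = (u' : ℤ_[p]) * (p : ℤ_[p]) ^ padicValNat p T * s := by
  have hpP : p.Prime := Fact.out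
  obtain ⟨m, rfl⟩ := hbT
  have hm : m ≠ 0 := fun hm ↦ hT (by rw [hm, mul_zero])
  set n := a * m with hn
  have hn0 : n ≠ 0 := mul_ne_zero ha hm
  -- prime-to-`p` parts
  have hnfac : n = p ^ padicValNat p n * ordCompl[p] n := by
    rw [← Nat.factorization_def _ hpP]; exact (Nat.ordProj_mul_ordCompl_eq_self _ p).symm
  have hTfac : b * m = p ^ padicValNat p (b * m) * ordCompl[p] (b * m) := by
    rw [← Nat.factorization_def _ hpP]; exact (Nat.ordProj_mul_ordCompl_eq_self _ p).symm
  have hu₁ : IsUnit ((ordCompl[p] n : ℕ) : ℤ_[p]) :=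
    PadicInt.isUnit_iff.mpr (PadicInt.norm_natCast_eq_one_iff.mpr
      ((Nat.Prime.coprime_iff_not_dvd hpP).mpr (Nat.not_dvd_ordCompl hpP hn0)))
  have hu₂ : IsUnit ((ordCompl[p] (b * m) : ℕ) : ℤ_[p]) :=
    PadicInt.isUnit_iff.mpr (PadicInt.norm_natCast_eq_one_iff.mpr
      ((Nat.Prime.coprime_iff_not_dvd hpP).mpr (Nat.not_dvd_ordCompl hpP hT)))
  obtain ⟨u₁, hu₁'⟩ := hu₁
  obtain ⟨u₂, hu₂'⟩ := hu₂
  -- `x · n = u · s · T` in `ℤ_p`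
  have key : x * (n : ℤ_[p]) = (u : ℤ_[p]) * s * ((b * m : ℕ) : ℤ_[p]) := by
    rw [hn]; push_cast; rw [← mul_assoc, h]; ring
  rw [hnfac, hTfac] at key
  push_cast at key
  rw [← hu₁', ← hu₂'] at key
  refine ⟨padicValNat p n, u * u₂ * u₁⁻¹, ?_⟩
  have hinv : (u₁ : ℤ_[p]) * ((u₁⁻¹ : ℤ_[p]ˣ) : ℤ_[p]) = 1 := by
    rw [← Units.val_mul, mul_inv_cancel, Units.val_one]
  push_cast
  linear_combination ((u₁⁻¹ : ℤ_[p]ˣ) : ℤ_[p]) * key -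
    ((p : ℤ_[p]) ^ padicValNat p n * x) * hinv

/-- **The Eisenstein half of the ♯/♭ `Γ`-Euler characteristic, in the kernel:
`p^k · f⋆(0) = u · p^{ord_p ∏_l c_l} · #Sel_{p^∞}(E/ℚ)` for some `k` and some unit `u`** — i.e.
`f⋆(0) ≠ 0` and `ord_p f⋆(0) ≤ ord_p ∏ c_l + ord_p #Sel`. Setting: `W/ℚ` elliptic and globally
minimal, `p ≠ 2` good supersingular (`p ∣ a_p`), the cyclotomic `κ` with topological generator `γ`,
`v ∋ p` with the chosen embedding, a local lift `g`, a Honda system `(cneg, c)`, either colour `⋆`,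
any Pontryagin-dual datum `D` of `Sel⋆(E/ℚ_∞)` with `X⋆` finitely generated torsion, `char(X⋆) = (f)`,
`Sel_{p^∞}(E/ℚ)` finite. From `f(0) · #(Sel⋆_∞)_γ = u · #Sel · #ker g`
(`constantCoeff_charGenerator_mul_natCard_sharpFlatEndCoinvariants_rat`, Lemmas 5.8 × 5.9 kernel;
`ker g` finite by `finite_sharpFlatKerG_of_localKerOver_of_layerToInfty_mem` + `lem55AllN_…_holds`) and
`#ker g ∣ ∏ c_l` (`natCard_sharpFlatKerG_dvd_tamagawaProduct`). NO Poitou–Tate, no Lemma 5.5, no K3.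
[cite: Sprung2024, §5.2 Lemmas 5.8, 5.9 and proof of Lemma 5.5 (pp. 40–41)]
[cite: GreenbergLNM1716, §4 Thm. 4.1, Lemmas 4.2–4.3, p. 104; §3 p. 88] -/
theorem exists_pow_mul_constantCoeff_charGenerator_eq (W : WeierstrassCurve ℚ) [W.IsElliptic]
    [W.IsGloballyMinimal] (p : ℕ) [Fact p.Prime] (hp2 : p ≠ 2) (hgood : W.HasGoodReductionAtPrime p)
    (hap : (p : ℤ) ∣ W.frobeniusTrace p) {κ : ZpExtension ℚ p} (hκ : κ.IsCyclotomic)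
    {γ : Field.absoluteGaloisGroup ℚ} (hγ : κ.IsTopGenerator γ)
    (v : HeightOneSpectrum (𝓞 ℚ)) (hv : (p : 𝓞 ℚ) ∈ v.asIdeal)
    {g : Field.absoluteGaloisGroup (v.adicCompletion ℚ)}
    (hg : κ.IsTopGenerator (resGalOfEmb (closureEmb (K := ℚ) (v.adicCompletion ℚ)) g))
    {cneg : localPoints W (v.adicCompletion ℚ)} {c : ℕ → localPoints W (v.adicCompletion ℚ)}
    (hH : IsHondaSystem κ (closureEmb (K := ℚ) (v.adicCompletion ℚ)) W (W.frobeniusTrace p) g cneg c)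
    (col : Chroma)
    (D : SharpFlatSelmerDualData W κ γ (closureEmb (K := ℚ) (v.adicCompletion ℚ))
      (W.frobeniusTrace p) g c col)
    [Module.Finite (IwasawaAlgebra p) D.X] (hX : Module.IsTorsion (IwasawaAlgebra p) D.X)
    (f : IwasawaAlgebra p) (hf : D.charIdeal = Ideal.span {f}) (hfin : Finite (W.selmerGroupPInfty p)) :
    ∃ (k : ℕ) (u : ℤ_[p]ˣ), (p : ℤ_[p]) ^ k * PowerSeries.constantCoeff f =
      (u : ℤ_[p]) * (p : ℤ_[p]) ^ padicValNat p W.tamagawaProduct * Nat.card (W.selmerGroupPInfty p) := by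
  -- `ker g` is finite ("`r_p` is injective", a tree theorem)
  have hkerg := finite_sharpFlatKerG_of_localKerOver_of_layerToInfty_mem W p κ v hv g c col
    (lem55AllN_sharpFlat_localKerOver_of_layerToInfty_mem_holds W p hp2 hgood hap κ hκ v hv g hg cneg c
      hH col)
  -- Lemmas 5.8 × 5.9 (kernel)
  obtain ⟨-, hco, -, u, hu⟩ := constantCoeff_charGenerator_mul_natCard_sharpFlatEndCoinvariants_rat
    W p hp2 hgood hap κ hγ v hg hH col D hX f hf hfin hkerg
  haveI := hco
  -- `#ker g ∣ ∏ c_v`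
  have hdvd := natCard_sharpFlatKerG_dvd_tamagawaProduct W p hp2 hgood hap hκ v hv hg hH col
  exact exists_pow_mul_eq_unit_mul_pow_padicValNat_mul (PowerSeries.constantCoeff f)
    (Nat.card_pos (α := EndCoinvariants (conjSharpFlatSelmerInfty W κ
      (closureEmb (K := ℚ) (v.adicCompletion ℚ)) (W.frobeniusTrace p) g c col γ - 1))).ne'
    (W.tamagawaProduct_pos').ne' hdvd u hu

/-! ## §3 The roads -/

/-- **Packaging `ξ := p^k · gen`**: from `p^k · gen(0) = u · p^{ord_p ∏ c_l} · #Sel` and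
`ι gen = ϖ · ι(L⋆ · h)`, the element `ξ = C(p^k) · gen ∈ Λ` satisfies Kim's identity
(`SignedDatum.EulerCharacteristic` of `⟨ξ, 0, 0⟩`) and `ι ξ = ϖ · ι(L⋆ · (h · C(p^k)))`.
[cite: RaySprung2025, §1.2 (p. 2343) (shape of Kim's identity)] [cite: Sprung2012, Main Conj. 7.21 (the divisibility shape)] -/
theorem chromaticDatum_of_pow_mul_constantCoeff_eq (W : WeierstrassCurve ℚ) [W.IsElliptic]
    (p : ℕ) [Fact p.Prime] (ϖ : ℚ) (L gen h : IwasawaAlgebra p) (k : ℕ) (u : ℤ_[p]ˣ)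
    (hk : (p : ℤ_[p]) ^ k * PowerSeries.constantCoeff gen =
      (u : ℤ_[p]) * (p : ℤ_[p]) ^ padicValNat p W.tamagawaProduct * Nat.card (W.selmerGroupPInfty p))
    (hι : iwasawaToPowerSeries p gen = PowerSeries.C (ϖ : ℚ_[p]) * iwasawaToPowerSeries p (L * h)) :
    (⟨PowerSeries.C ((p : ℤ_[p]) ^ k) * gen, 0, 0⟩ : SignedDatum W p).EulerCharacteristic ∧
      ∃ h' : IwasawaAlgebra p, iwasawaToPowerSeries p (PowerSeries.C ((p : ℤ_[p]) ^ k) * gen) =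
        PowerSeries.C (ϖ : ℚ_[p]) * iwasawaToPowerSeries p (L * h') := by
  refine ⟨fun _ ↦ ⟨u, ?_⟩, h * PowerSeries.C ((p : ℤ_[p]) ^ k), ?_⟩
  · change ((PowerSeries.constantCoeff (PowerSeries.C ((p : ℤ_[p]) ^ k) * gen) : ℤ_[p]) : ℚ_[p]) = _
    rw [map_mul, PowerSeries.constantCoeff_C, hk]
    push_cast
    ring
  · rw [map_mul, hι, map_mul, map_mul, map_mul]
    ring

/-- **ROUTE-GLUE form: `K1 → S4 → SprungLowerHalfAtThree`** (crux 5 BY NAME from K1 =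
`SprungLowerDivisibilityAtThree` ((MC↓•), OPEN) and the HELD published-input bundle S4 =
`SharpFlatPublishedInputsAtThree` alone — NO K2, NO K3). For an X8 pair: S4(M) gives a newform, stub
(A) the real `(f, ϖ, L♯, L♭)` (`stub_sprungPair_of_isNewformOf`); if `Sel_{3^∞}(E/ℚ)` is infinite
`ξ = 0` works (`chromaticDatum_of_not_finite_selmer`); else: the cyclotomic setting, the local lift
(tree), S4(H) a Honda system, the Rohrlich colour `L⋆ ≠ 0` (Prop. 6.14, tree), Sprung's real `X⋆`, K1
⇒ `char(X⋆) = (gen)`, `ι gen = ϖ·ι(L⋆·h)`, S4(T) cotorsion, and §2 ⇒ `3^k · gen(0) = u · 3^{ord₃ ∏c_l}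
· #Sel`; `ξ := 3^k · gen` (`chromaticDatum_of_pow_mul_constantCoeff_eq`). On ACCEPT the planner's
announced edit is `--resplit SprungLowerHalfAtThree --into SprungLowerDivisibilityAtThree
SharpFlatPublishedInputsAtThree --glue sprungLowerHalfAtThree_of_K1_S4` (D30-5). CONDITIONAL on K1
(OPEN) and S4 (HELD); closes nothing. [cite: Sprung2012, Thm. 2.2, Thm. 7.14, Prop. 6.14 and Main Conj. 7.21]
[cite: Sprung2024, §5.2 Lemmas 5.8–5.9 and proof of Lemma 5.5 (pp. 40–41)]
[cite: GreenbergLNM1716, §3 p. 88, §4 p. 104] [cite: BCDTJAMS2001, Thm. A] -/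
theorem sprungLowerHalfAtThree_of_K1_S4 (hK1 : SprungLowerDivisibilityAtThree)
    (hS4 : SharpFlatPublishedInputsAtThree) : SprungLowerHalfAtThree := by
  intro W _ _ p _ hX
  -- S4(M): a newform of `W`; stub (A): the real objects `(f, ϖ, L♯, L♭)`
  obtain ⟨⟨N₀, hN₀, f₀, hf₀⟩, hS4'⟩ := hS4 W p hX
  haveI := hN₀
  obtain ⟨N, hN, f, ϖ, Lsharp, Lflat, hf, hϖ, hSP⟩ :=
    stub_sprungPair_of_isNewformOf W p hX f₀ hf₀
  suffices hB : ∃ (col : Chroma) (ξ : IwasawaAlgebra p),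
      (⟨ξ, 0, 0⟩ : SignedDatum W p).EulerCharacteristic ∧
        ∃ h : IwasawaAlgebra p, iwasawaToPowerSeries p ξ =
          PowerSeries.C (ϖ : ℚ_[p]) * iwasawaToPowerSeries p (chromaticL col Lsharp Lflat * h) by
    obtain ⟨col, ξ, hK, hdiv⟩ := hB
    exact ⟨N, hN, f, ϖ, Lsharp, Lflat, col, ξ, hf, hϖ, hSP, hK, hdiv⟩
  -- positive corank: `ξ = h = 0`
  by_cases hfin : Finite (W.selmerGroupPInfty p)
  swap
  · exact ⟨.flat, chromaticDatum_of_not_finite_selmer W p hfin ϖ (chromaticL .flat Lsharp Lflat)⟩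
  -- corank zero: `p = 3`, the cyclotomic setting, the local lift (PROVED), a Honda system
  have hp3 : p = 3 := hX.1
  subst hp3
  have hp2 : (3 : ℕ) ≠ 2 := by decide
  have hgood : W.HasGoodReductionAtPrime 3 := hX.2.1.1
  have hdvd : ((3 : ℕ) : ℤ) ∣ W.frobeniusTrace 3 := hX.2.1.2
  obtain ⟨κ, hκ, γ, hγ, hγ'⟩ := exists_isCyclotomic_isTopGenerator_isCyclotomicVariable_holds 3
  obtain ⟨v, hv⟩ :=
    Literature.NumberTheory.NumberFields.RingOfIntegers.exists_heightOneSpectrum_natCast_mem ℚ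
      (p := 3) (by norm_num)
  obtain ⟨g, hg⟩ := hκ.exists_isTopGenerator_resGalOfEmb_adicCompletion v hv
  obtain ⟨⟨cneg, c, hc⟩, h714⟩ := hS4' κ γ hκ hγ hγ' v hv g hg
  -- a colour with `L^• ≠ 0` (Sprung 2012 Prop. 6.14, tree theorem)
  obtain ⟨col, hcol⟩ := hSP.exists_chromaticL_ne_zero hf hgood
  -- Sprung's real `X^•(E/ℚ_∞)`
  let D := sharpFlatSelmerDualData W κ (closureEmb (K := ℚ) (v.adicCompletion ℚ))
    (W.frobeniusTrace 3) g c col hγ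
  -- (MC↓•) by name: a generator of `char_Λ(X^•)` divisible by `ϖ · L^•`
  obtain ⟨gen, h, hchar, hι⟩ :=
    hK1 W 3 hX col κ γ hκ hγ hγ' v hv g hg cneg c hc N hN f ϖ Lsharp Lflat hf hϖ hSP hcol D
  -- cotorsion (S4(T) = Sprung 2012 Thm. 7.14)
  haveI := hN
  obtain ⟨hfinD, htorD⟩ := h714 cneg c hc N hN f hf col Lsharp Lflat hSP hcol D
  haveI := hfinD
  -- the Eisenstein half of the Euler characteristic (kernel): `3^k · gen(0) = u · 3^{v₃ ∏c} · #Sel`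
  obtain ⟨k, u, hk⟩ := exists_pow_mul_constantCoeff_charGenerator_eq W 3 hp2 hgood hdvd hκ hγ v hv hg
    hc col D htorD gen hchar hfin
  exact ⟨col, _, chromaticDatum_of_pow_mul_constantCoeff_eq W 3 ϖ (chromaticL col Lsharp Lflat) gen h
    k u hk hι⟩

/-- **Binder form, Kato-free: `K1 → thm22 → exists_isNewformOf → SprungLowerHalfAtThree`** (crux 5 BY
NAME with every discharged input fed by the tree). As `sprungLowerHalfAtThree_of_K1_S4` but with (M)
from `exists_isNewformOf`, (H) from `Sprung2012.thm22_exists_isHondaSystem`, and — in the corank-zero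
branch — cotorsion WITHOUT Thm. 7.14: `X⋆` finitely generated by `SharpFlatSelmerDualData.moduleFinite`
(Nakayama for duals), `Sel_{3^∞}(E/ℚ)` finite ⟹ `X⋆/TX⋆` finite (Lemma 5.6, the tree theorem
`Sprung2024.lem56AllN_…_holds`, cell `pub/bsd-cited`) ⟹ `X⋆` torsion
(`isTorsion_and_constantCoeff_ne_zero_of_finite_coinvariants`). NET NAMED INPUTS: K1 (OPEN),
`Sprung2012.thm22_exists_isHondaSystem`, `exists_isNewformOf` — nothing from Sprung 2024 §5.2, no
Prop. 7.3 / 7.6 / Lemma 2.3 / Thm. 7.14 binders (all kernel). CONDITIONAL on K1 (OPEN) and the two named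
facts; closes nothing; 0 cells move. [cite: Sprung2012, Thm. 2.2, Prop. 6.14 and Main Conj. 7.21]
[cite: Sprung2024, §5.2 Lemmas 5.6–5.9 and proof of Lemma 5.5 (pp. 40–41)]
[cite: GreenbergLNM1716, §1 p. 61, §3 p. 88, §4 pp. 102–104] [cite: BCDTJAMS2001, Thm. A] -/
theorem sprungLowerHalfAtThree_of_lowerDivisibility_katoFree (hK1 : SprungLowerDivisibilityAtThree)
    (h22 : Sprung2012.thm22_exists_isHondaSystem) (hmod : exists_isNewformOf) :
    SprungLowerHalfAtThree := by
  intro W _ _ p _ hX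
  -- (M): a newform of `W`; stub (A): the real objects `(f, ϖ, L♯, L♭)`
  haveI hN₀ : NeZero (W.conductorNorm ℤ) := ⟨(W.conductorNorm_pos_holds).ne'⟩
  obtain ⟨f₀, hf₀⟩ := hmod W
  obtain ⟨N, hN, f, ϖ, Lsharp, Lflat, hf, hϖ, hSP⟩ :=
    stub_sprungPair_of_isNewformOf W p hX f₀ hf₀
  suffices hB : ∃ (col : Chroma) (ξ : IwasawaAlgebra p),
      (⟨ξ, 0, 0⟩ : SignedDatum W p).EulerCharacteristic ∧
        ∃ h : IwasawaAlgebra p, iwasawaToPowerSeries p ξ =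
          PowerSeries.C (ϖ : ℚ_[p]) * iwasawaToPowerSeries p (chromaticL col Lsharp Lflat * h) by
    obtain ⟨col, ξ, hK, hdiv⟩ := hB
    exact ⟨N, hN, f, ϖ, Lsharp, Lflat, col, ξ, hf, hϖ, hSP, hK, hdiv⟩
  -- positive corank: `ξ = h = 0`
  by_cases hfin : Finite (W.selmerGroupPInfty p)
  swap
  · exact ⟨.flat, chromaticDatum_of_not_finite_selmer W p hfin ϖ (chromaticL .flat Lsharp Lflat)⟩
  -- corank zero
  have hp3 : p = 3 := hX.1
  subst hp3
  have hp2 : (3 : ℕ) ≠ 2 := by decide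
  have hgood : W.HasGoodReductionAtPrime 3 := hX.2.1.1
  have hdvd : ((3 : ℕ) : ℤ) ∣ W.frobeniusTrace 3 := hX.2.1.2
  obtain ⟨κ, hκ, γ, hγ, hγ'⟩ := exists_isCyclotomic_isTopGenerator_isCyclotomicVariable_holds 3
  obtain ⟨v, hv⟩ :=
    Literature.NumberTheory.NumberFields.RingOfIntegers.exists_heightOneSpectrum_natCast_mem ℚ
      (p := 3) (by norm_num)
  obtain ⟨g, hg⟩ := hκ.exists_isTopGenerator_resGalOfEmb_adicCompletion v hv
  -- (H): a Honda system
  obtain ⟨cneg, c, hc⟩ := h22 W 3 hp2 hgood hdvd κ γ hκ hγ hγ' v hv g hg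
  -- a colour with `L^• ≠ 0` and Sprung's real `X^•(E/ℚ_∞)`
  obtain ⟨col, hcol⟩ := hSP.exists_chromaticL_ne_zero hf hgood
  let D := sharpFlatSelmerDualData W κ (closureEmb (K := ℚ) (v.adicCompletion ℚ))
    (W.frobeniusTrace 3) g c col hγ
  -- (MC↓•) by name
  obtain ⟨gen, h, hchar, hι⟩ :=
    hK1 W 3 hX col κ γ hκ hγ hγ' v hv g hg cneg c hc N hN f ϖ Lsharp Lflat hf hϖ hSP hcol D
  haveI := hN
  -- finite generation (Nakayama for duals) and torsion (control, Lemma 5.6 a tree theorem)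
  haveI : Module.Finite (IwasawaAlgebra 3) D.X := D.moduleFinite hγ
  have hco : Finite (IwasawaAlgebra.coinvariants 3 D.X) :=
    lem56AllN_sharpFlat_finite_coinvariants_of_finite_selmer_holds W 3 hp2 hgood hdvd κ γ hκ hγ hγ' v hv
      g hg cneg c hc col D hfin
  obtain ⟨htorD, -⟩ := D.isTorsion_and_constantCoeff_ne_zero_of_finite_coinvariants hγ hco hchar
  -- the Eisenstein half of the Euler characteristic (kernel)
  obtain ⟨k, u, hk⟩ := exists_pow_mul_constantCoeff_charGenerator_eq W 3 hp2 hgood hdvd hκ hγ v hv hg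
    hc col D htorD gen hchar hfin
  exact ⟨col, _, chromaticDatum_of_pow_mul_constantCoeff_eq W 3 ϖ (chromaticL col Lsharp Lflat) gen h
    k u hk hι⟩

/-- **K2 `SharpFlatRankZeroConverseAtThree` ((conv₀)) with its discharged binders dropped:
`thm22 → exists_isNewformOf → K1 → K2`** (g5's Kato-free road
`sharpFlatRankZeroConverseAtThree_katoFree_of_sprungLowerDivisibility_of_lem55` fed with the tree
theorem `Sprung2024.lem55AllN_…_holds` of cell `pub/bsd-cited`). CONDITIONAL on K1 (OPEN) and the two
named facts; closes nothing. [cite: Sprung2024, §5.2 proof of Lemma 5.5 (p. 40), Lemma 5.6 (p. 41)]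
[cite: Sprung2012, Thm. 2.2 and Main Conj. 7.21] [cite: BCDTJAMS2001, Thm. A] -/
theorem sharpFlatRankZeroConverseAtThree_katoFree (h22 : Sprung2012.thm22_exists_isHondaSystem)
    (hmod : exists_isNewformOf) (hK1 : SprungLowerDivisibilityAtThree) :
    SharpFlatRankZeroConverseAtThree :=
  sharpFlatRankZeroConverseAtThree_katoFree_of_sprungLowerDivisibility_of_lem55
    lem55AllN_sharpFlat_localKerOver_of_layerToInfty_mem_holds hmod h22 hK1

end Summit.BirchSwinnertonDyer.BirchSwinnertonDyer.Theorems.SprungLowerHalfAtThreeSplit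

end
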